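import Literature.Analysis.FluidPDE.LoadedSphereDynamics
import Literature.Analysis.FluidPDE.HardSphereCollisionRecordMeasurable
import HarnessLib

/-!
# Contact records, contact phases and the coarse past of a loaded-sphere flow

Definition request `defn-LoadedCollisionRecord` (route `JeansLoadedDice`, crux `PhaseFreshness`,
`AtomisticToContinuum/HydrodynamicLimit`): the flow-level collision-record API of
`Literature.Analysis.FluidPDE.HardSphereCollisionRecord` ported from `HardSphereFlow` to the
loaded-sphere flow `LoadedSphereFlow G ε ξ ι N` of `LoadedSphereDynamics` (Jeans' smooth spheres with
an eccentric mass centre, Chapman–Cowling 1970 §11.1). A loaded-sphere trajectory `γ`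
(`IsLoadedSphereTrajectory`, the loaded copy of GST 2013 Def. 4.1.2) has the contact times
`collisionTimes G ε (fun t => loadedProjection (γ t))` OF ITS PROJECTION to geometric centres and
mass-centre velocities, so everything positional — contact pairs `contactPairs`, participation
`Participates`, partners `partner`, collision times of a particle `collisionTimesOf`, flight starts
`flightStart`, the enumerators `nthCollisionTimeOf` — is REUSED from the hard-sphere file on the
projected orbit; only what involves load directions and angular momenta is new.

* `LoadedCollisionRecord X N` — the record of one contact: time, ordered pair, the two geometric
  centres, the unit contact normal `n` (from `fst` to `snd`, `loadedNormal`), the CONTACT PHASES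
  (load directions `(a_fst, a_snd)` at the contact instant), the incoming and the outgoing pair data
  `((V_fst, V_snd), (L_fst, L_snd))`; `LoadedCollisionRecord.ofConfig G ε ξ ι z t i j` reads it off
  the (right-continuous, post-collisional) loaded configuration `z = γ t`, the incoming data being
  recovered by the INVOLUTION `loadedPostData` (`loadedImpact_loadedImpact`; they ARE the data of the
  left limit, `IsLoadedSphereTrajectory.ofConfig_preData_eq_leftLim`), exactly as
  `HardSphereCollisionRecord.ofConfig` uses `reflectVel`; `.inDir = ĝ`, the unit incoming relative
  mass-centre velocity.
* along a loaded-sphere TRAJECTORY (namespace `IsLoadedSphereTrajectory`): binary contacts in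
  ordered form, `participates_iff`, `partner_eq` (the partner is THE partner), finiteness of the
  collision times of a particle in bounded windows, flight starts, collision-free one-sided
  neighbourhoods, RIGHT-CONTINUITY (`tendsto_nhdsGT`, from `free` and the continuity of
  `loadedFreeFlight` in time), left limits (`tendsto_nhdsLT`, `tendsto_leftLim`), and the
  pre-collisional configuration as the involution of the value: `loadedCollide_loadedCollide`,
  `tendsto_loadedCollide`, `leftLim_eq_loadedCollide` (the loaded `leftLim_eq_collidePair`).
* along a loaded-sphere FLOW `Ψ`, as functions of the initial datum `z` (namespace
  `LoadedSphereFlow`): `Ψ.nthCollisionTimeOf i n z` (the `n`-th contact time of particle `i` after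
  time `0`), `Ψ.nthContactConfig`, `Ψ.nthPartnerOf`, `Ψ.flightStartOf` / `Ψ.partnerFlightStartOf`
  (starts of the two free flights ending in this contact), `Ψ.nthContactPhases = (a_i, a_j)`,
  `Ψ.nthContactNormal`, `Ψ.nthPostData`, `Ψ.nthPreData` (incoming data), `Ψ.nthInDir = ĝ`,
  `Ψ.nthRecordOf`; the COARSE PAST `Ψ.coarsePastOf q qv i n z` — the loaded configurations of ALL
  particles at the two flight starts, geometric centres seen through `q : X → C` and mass-centre
  velocities, load directions and angular momenta through `qv : ℝ³ → Cv` (`loadedCoarseConfig`) —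
  with its σ-algebra `Ψ.coarsePastSigma q qv i n = MeasurableSpace.comap (Ψ.coarsePastOf q qv i n)`,
  and the finer `Ψ.coarsePastOthersSigma q qv i n`, generated in addition by the EXACT initial data
  of every particle other than `i` and its `n`-th partner (`Ψ.othersInitialOf`, the pair masked); so
  that `MeasureTheory.condExp` / `ProbabilityTheory.condDistrib` of the contact phases given the
  coarse past are typable; the loaded collision pair sum `Ψ.collisionPairSum`.
* the EXCEPTIONAL CONTACT CLASSES of the phase-freshness mechanism, as predicates on `(i, n, z)`:
  `Ψ.IsRecontact` (same partner as in the previous contact of `i`), `Ψ.IsShortFlight … s` (one of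
  the two flights ending here is shorter than `s`), `Ψ.IsGrazing … δ` (`|⟪ĝ, n⟫| < δ`), `Ψ.IsPolar … δ`
  (`|⟪a, n⟫| > 1 - δ` for one of the two contact phases).

The measurability of all these maps in the initial datum (jointly measurable flow on the good set,
hitting times of closed position events) is the companion file `LoadedCollisionRecordMeasurable`;
here only the σ-algebra bookkeeping (`coarsePastSigma_le`, `measurable_coarsePastOf_coarsePastSigma`,
`coarsePastOthersSigma_le`) is recorded, in the hypothesis form of the hard-sphere file.

## Mathlib / Literature reuse

`Function.leftLim`, `MeasurableSpace.comap`, `Sum.instMeasurableSpace`, `sSup`/`sInf` on `ℝ` are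
Mathlib's; `contactPairs`, `Collide`, `Participates`, `partner`, `collisionTimesOf`, `flightStart`,
`nextTimeAfter`, `nthTimeAfter`, `nthCollisionTimeOf`, `collisionPairSum` are
`HardSphereCollisionRecord`'s, applied to the projected orbit; `loadedNormal`, `loadedPairData`,
`loadedPostData`, `loadedCollide`, `IsLoadedIncoming`, `loadedImpact_loadedImpact`,
`IsLoadedSphereTrajectory`, `LoadedSphereFlow` are `LoadedSphereDynamics`'. Nothing is redefined.

## Design choices

* ONE CUT-OFF: `Ψ.nthCollisionTimeOf i n z` is the hard-sphere enumerator of the projected orbit for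
  `z ∈ Ψ.good` and the junk value `0` OFF the good set (where the flow itself is junk). With this
  single convention every flow-level map of this file is a GLOBALLY measurable function of the
  initial datum (companion file), so that `Ψ.coarsePastSigma q qv i n ≤ ‹ambient›` holds outright and
  conditional expectations given the coarse past are not junk; `HardSphereFlow.nthCollisionTimeOf`
  has junk values off the good set too, only different ones. The flight starts need no cut-off
  (`flightStart … 0 k 0 = 0`).
* Incoming data by the involution (`nthPreData := loadedPostData` of the post-collisional value),
  not by `Function.leftLim`: no topology is needed to define them and they are visibly measurable;
  the identification with the left limit is a theorem (`ε ≠ 0`, `0 < ι`, Hausdorff `X`).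
* The index set "all particles but `i` and its partner" depends on `z` through the partner; the
  exact data of the others are therefore encoded as ONE map `Ψ.othersInitialOf i n z : Fin N →
  Unit ⊕ ((X × ℝ³) × (ℝ³ × ℝ³))` masking the colliding pair (`Sum.inl ()`), whose generated
  σ-algebra is "the partner, and the initial data of everybody else".
* Ordered pairs, windows, junk values: as in `HardSphereCollisionRecord` (`partner z i = i` if `i`
  touches nobody; `sInf ∅ = sSup ∅ = 0`; `n - 1` in `IsRecontact` is guarded by `n ≠ 0`).
* Deliberately NOT here: existence of loaded flows (a route statement), any conditional-law or
  frequency statement about the exceptional classes (route items), collision DAGs.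

## References

* I. Gallagher, L. Saint-Raymond, B. Texier, *From Newton to Boltzmann* (2013), §4.1, Def. 4.1.2
  (collisions of the hard-sphere flow; trajectory conventions).
* S. Chapman, T. G. Cowling, *The Mathematical Theory of Non-uniform Gases*, 3rd ed. (1970), §11.1
  (Jeans' loaded spheres).
* K. Aoki, M. Pulvirenti, S. Simonella, T. Tsuji, *Backward clusters, hierarchy and wild sums for a
  hard sphere system in a low-density regime*, M3AS 25 (2015), §5 (collision records).
-/

open Set Filter Function MeasureTheory Metric
open scoped Topology InnerProductSpace

namespace Literature.Analysis.FluidPDE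

noncomputable section

local notation "E³" => EuclideanSpace ℝ (Fin 3)

/-! ## The record of one contact of loaded spheres -/

/-- The **record of one contact** of `N` loaded spheres with geometric centres in `X`: its time, the
ORDERED colliding pair `(fst, snd)`, the geometric centres of the two partners, the unit contact
normal `n` from `fst` to `snd`, the contact phases (load directions `(a_fst, a_snd)` at the contact
instant), and the incoming and outgoing pair data `((V_fst, V_snd), (L_fst, L_snd))` (mass-centre
velocities and angular momenta). The loaded copy of `HardSphereCollisionRecord` (GST 2013 §4.1: a
collision is the datum of its time, pair, impact direction and incoming/outgoing velocities).
[cite: GST2013, §4.1] -/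
structure LoadedCollisionRecord (X : Type*) (N : ℕ) where
  /-- The contact time. -/
  time : ℝ
  /-- The first particle of the (ordered) colliding pair. -/
  fst : Fin N
  /-- The second particle of the (ordered) colliding pair. -/
  snd : Fin N
  /-- The geometric centre of the first particle at the contact. -/
  fstPos : X
  /-- The geometric centre of the second particle at the contact. -/
  sndPos : X
  /-- The unit contact normal, from the first to the second geometric centre. -/
  normal : E³
  /-- The contact phases: the load directions `(a_fst, a_snd)` at the contact instant. -/
  phases : E³ × E³
  /-- The incoming pair data `((V_fst⁻, V_snd⁻), (L_fst⁻, L_snd⁻))`. -/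
  preData : (E³ × E³) × (E³ × E³)
  /-- The outgoing pair data `((V_fst⁺, V_snd⁺), (L_fst⁺, L_snd⁺))`. -/
  postData : (E³ × E³) × (E³ × E³)

namespace LoadedCollisionRecord

variable {X : Type*} {N : ℕ}

/-- The unordered colliding pair `{fst, snd}` of a record. [folklore] -/
def pair (c : LoadedCollisionRecord X N) : Finset (Fin N) := {c.fst, c.snd}

/-- The unit INCOMING relative mass-centre velocity `ĝ = (V_fst⁻ - V_snd⁻)/|V_fst⁻ - V_snd⁻|` of a
record (junk value `0` if the incoming velocities coincide). [folklore] -/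
def inDir (c : LoadedCollisionRecord X N) : E³ :=
  ‖c.preData.1.1 - c.preData.1.2‖⁻¹ • (c.preData.1.1 - c.preData.1.2)

/-- The unit OUTGOING relative mass-centre velocity of a record (junk value `0` if the outgoing
velocities coincide). [folklore] -/
def outDir (c : LoadedCollisionRecord X N) : E³ :=
  ‖c.postData.1.1 - c.postData.1.2‖⁻¹ • (c.postData.1.1 - c.postData.1.2)

/-- The incoming direction is a unit vector as soon as the incoming velocities differ. [folklore] -/
theorem norm_inDir {c : LoadedCollisionRecord X N} (h : c.preData.1.1 ≠ c.preData.1.2) :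
    ‖c.inDir‖ = 1 := by
  have hne : ‖c.preData.1.1 - c.preData.1.2‖ ≠ 0 := norm_ne_zero_iff.2 (sub_ne_zero.2 h)
  rw [inDir, norm_smul, norm_inv, norm_norm, inv_mul_cancel₀ hne]

/-- The outgoing direction is a unit vector as soon as the outgoing velocities differ. [folklore] -/
theorem norm_outDir {c : LoadedCollisionRecord X N} (h : c.postData.1.1 ≠ c.postData.1.2) :
    ‖c.outDir‖ = 1 := by
  have hne : ‖c.postData.1.1 - c.postData.1.2‖ ≠ 0 := norm_ne_zero_iff.2 (sub_ne_zero.2 h)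
  rw [outDir, norm_smul, norm_inv, norm_norm, inv_mul_cancel₀ hne]

/-- The record of the contact of the ordered pair `(i, j)` at time `t` read off the loaded
configuration `z` (for a right-continuous loaded-sphere trajectory `z = γ t` is the POST-collisional
configuration): geometric centres, phases and outgoing data are those of `z`, the normal is
`loadedNormal G z i j`, and the incoming data are recovered by the involution `loadedPostData`
(`loadedImpact_loadedImpact`; they are the data of the left limit,
`IsLoadedSphereTrajectory.ofConfig_preData_eq_leftLim`). [folklore] -/
@[simps]
def ofConfig (G : Geometry (Fin 3) X) (ε ξ ι : ℝ) (z : LoadedConfig N X) (t : ℝ) (i j : Fin N) :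
    LoadedCollisionRecord X N where
  time := t
  fst := i
  snd := j
  fstPos := (z i).1.1
  sndPos := (z j).1.1
  normal := loadedNormal G z i j
  phases := ((z i).2.1, (z j).2.1)
  preData := loadedPostData G ε ξ ι z i j
  postData := loadedPairData z i j

end LoadedCollisionRecord

/-! ## The loaded collision as an involution on configurations -/

section Pair

variable {X : Type*} {N : ℕ} {G : Geometry (Fin 3) X} {ε ξ ι : ℝ} {i j : Fin N}

/-- The cross product with the zero vector vanishes (private copy of the tree's
`Literature.Analysis.FluidPDE.cross_zero_right`, `KinematicHubbleThreshold.lean`, whose import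
closure is foreign to this kinetic file). [folklore] -/
@[simp]
private theorem cross_right_zero (a : E³) : cross a 0 = 0 :=
  (crossCLM a).map_zero

/-- With a vanishing normal (the junk value of `loadedNormal`) the impact map is the identity.
[folklore] -/
@[simp]
theorem loadedImpact_normal_zero (ε ξ ι : ℝ) (ai aj : E³) (p : (E³ × E³) × (E³ × E³)) :
    loadedImpact ε ξ ι ai aj 0 p = p := by
  simp [loadedImpact]

/-- The contact normal is a unit vector or the junk value `0`. [folklore] -/
theorem loadedNormal_eq_zero_or_norm_eq_one (G : Geometry (Fin 3) X) (z : LoadedConfig N X)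
    (i j : Fin N) : loadedNormal G z i j = 0 ∨ ‖loadedNormal G z i j‖ = 1 := by
  by_cases hm : G.sepVec (z j).1.1 (z i).1.1 = 0
  · left
    simp [loadedNormal, hm]
  · right
    rw [loadedNormal, norm_smul, norm_inv, norm_norm, inv_mul_cancel₀ (norm_ne_zero_iff.2 hm)]

/-- The contact normal only depends on the geometric centres. [folklore] -/
theorem loadedNormal_congr_pos {z z' : LoadedConfig N X} (h : ∀ k, (z k).1.1 = (z' k).1.1)
    (i j : Fin N) : loadedNormal G z i j = loadedNormal G z' i j := by
  simp only [loadedNormal, h]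

/-- A loaded collision does not change the contact normals. [folklore] -/
@[simp]
theorem loadedNormal_loadedCollide (z : LoadedConfig N X) (i j k l : Fin N) :
    loadedNormal G (loadedCollide G ε ξ ι k l z) i j = loadedNormal G z i j :=
  loadedNormal_congr_pos (fun m => loadedCollide_apply_pos z m) i j

/-- After the collision of `(i, j)` the pair carries the post-impact data. [folklore] -/
theorem loadedPairData_loadedCollide (hij : i ≠ j) (z : LoadedConfig N X) :
    loadedPairData (loadedCollide G ε ξ ι i j z) i j = loadedPostData G ε ξ ι z i j := by
  simp only [loadedPairData, loadedCollide_apply_left hij, loadedCollide_apply_right]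

/-- **Undoing a loaded collision**: applying the impact map to the post-collisional pair data of
`loadedCollide G ε ξ ι i j z` returns the pair data of `z` (unit load directions at `i, j`,
`ε ≠ 0`, `0 < ι`; the impact map is an involution, `loadedImpact_loadedImpact`). [folklore] -/
theorem loadedPostData_loadedCollide (hε : ε ≠ 0) (hι : 0 < ι) (hij : i ≠ j) {z : LoadedConfig N X}
    (hi : ‖(z i).2.1‖ = 1) (hj : ‖(z j).2.1‖ = 1) :
    loadedPostData G ε ξ ι (loadedCollide G ε ξ ι i j z) i j = loadedPairData z i j := by
  rw [loadedPostData, loadedPairData_loadedCollide hij, loadedNormal_loadedCollide,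
    loadedCollide_apply_dir, loadedCollide_apply_dir, loadedPostData]
  rcases loadedNormal_eq_zero_or_norm_eq_one G z i j with h0 | h1
  · rw [h0, loadedImpact_normal_zero, loadedImpact_normal_zero]
  · exact loadedImpact_loadedImpact hε hι hi hj h1 _

/-- **The loaded collision is an involution** on configurations with unit load directions at the
colliding pair (`ε ≠ 0`, `0 < ι`): the loaded analogue of `collidePair_collidePair`. [folklore] -/
theorem loadedCollide_loadedCollide (hε : ε ≠ 0) (hι : 0 < ι) (hij : i ≠ j) {z : LoadedConfig N X}
    (hi : ‖(z i).2.1‖ = 1) (hj : ‖(z j).2.1‖ = 1) :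
    loadedCollide G ε ξ ι i j (loadedCollide G ε ξ ι i j z) = z := by
  have hpost := loadedPostData_loadedCollide (G := G) (ξ := ξ) hε hι hij hi hj
  funext k
  by_cases hkj : k = j
  · subst hkj
    rw [loadedCollide_apply_right, hpost, loadedCollide_apply_pos, loadedCollide_apply_dir]
    rfl
  by_cases hki : k = i
  · subst hki
    rw [loadedCollide_apply_left hkj, hpost, loadedCollide_apply_pos, loadedCollide_apply_dir]
    rfl
  rw [loadedCollide_apply_of_ne hki hkj, loadedCollide_apply_of_ne hki hkj]

/-- The incoming data recorded by `ofConfig` are the pair data of the configuration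
`loadedCollide G ε ξ ι i j z` obtained by undoing the impact (definitionally: both are the
post-impact data `loadedPostData G ε ξ ι z i j`). [folklore] -/
theorem LoadedCollisionRecord.ofConfig_preData_eq_loadedPairData_loadedCollide (hij : i ≠ j)
    (z : LoadedConfig N X) (t : ℝ) :
    (LoadedCollisionRecord.ofConfig G ε ξ ι z t i j).preData =
      loadedPairData (loadedCollide G ε ξ ι i j z) i j := by
  rw [LoadedCollisionRecord.ofConfig_preData, loadedPairData_loadedCollide hij]

/-- Free rotation of the load direction is continuous in time. [folklore] -/
theorem continuous_loadDir (ε ι : ℝ) (a L : E³) : Continuous fun t => loadDir ε ι t a L := by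
  unfold loadDir rodrigues
  fun_prop

/-- If each translation `v ↦ x + v` is continuous, loaded free-motion orbits are continuous in time.
[folklore] -/
theorem continuous_loadedFreeFlight_of_continuous_translate [TopologicalSpace X]
    (hG : ∀ x : X, Continuous (G.translate x)) (ε ξ ι : ℝ) (z : LoadedConfig N X) :
    Continuous fun t : ℝ => loadedFreeFlight G ε ξ ι t z := by
  refine continuous_pi fun k => ?_
  have h1 := hG (z k).1.1
  have h2 := continuous_loadDir ε ι (z k).2.1 (z k).2.2
  change Continuous fun t : ℝ => ((G.translate (z k).1.1
    (t • (z k).1.2 + (ξ * ε) • (loadDir ε ι t (z k).2.1 (z k).2.2 - (z k).2.1)), (z k).1.2),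
    (loadDir ε ι t (z k).2.1 (z k).2.2, (z k).2.2))
  fun_prop

end Pair

/-! ## Coarse-graining of loaded configurations -/

section Coarse

variable {X : Type*} {N : ℕ}

/-- The **coarse-grained loaded configuration**: geometric centres seen through `q : X → C` (cells of
a mesh, or `id`), mass-centre velocities, load directions and angular momenta seen through
`qv : ℝ³ → Cv` (velocity / phase cells, or `id` for exact values). [folklore] -/
def loadedCoarseConfig {C Cv : Type*} (q : X → C) (qv : E³ → Cv) (z : LoadedConfig N X) :
    Fin N → (C × Cv) × (Cv × Cv) :=
  fun k => ((q (z k).1.1, qv (z k).1.2), (qv (z k).2.1, qv (z k).2.2))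

/-- Unfolding lemma for the coarse-grained loaded configuration. [folklore] -/
@[simp]
theorem loadedCoarseConfig_apply {C Cv : Type*} (q : X → C) (qv : E³ → Cv) (z : LoadedConfig N X)
    (k : Fin N) :
    loadedCoarseConfig q qv z k = ((q (z k).1.1, qv (z k).1.2), (qv (z k).2.1, qv (z k).2.2)) :=
  rfl

/-- Coarse-graining through identities keeps the configuration. [folklore] -/
theorem loadedCoarseConfig_id (z : LoadedConfig N X) : loadedCoarseConfig id id z = z := by
  funext k
  simp

/-- The coarse-grained loaded configuration is measurable in the configuration when the two cell
maps are. [folklore] -/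
theorem measurable_loadedCoarseConfig [MeasurableSpace X] {C Cv : Type*} [MeasurableSpace C]
    [MeasurableSpace Cv] {q : X → C} {qv : E³ → Cv} (hq : Measurable q) (hqv : Measurable qv) :
    Measurable (loadedCoarseConfig (N := N) q qv) := by
  refine measurable_pi_lambda _ fun k => ?_
  have hk : Measurable fun z : LoadedConfig N X => z k := measurable_pi_apply k
  exact ((hq.comp hk.fst.fst).prodMk (hqv.comp hk.fst.snd)).prodMk
    ((hqv.comp hk.snd.fst).prodMk (hqv.comp hk.snd.snd))

/-- The **`r`-cells of `ℝ³`**: `v ↦ (⌊v_i / r⌋)_i`, the coarse-graining map of mesh `r` for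
mass-centre velocities, load directions and angular momenta (the `qv` of `loadedCoarseConfig`;
companion of `Torus.coarseCell` for positions). [folklore] -/
def Euclidean.coarseCell (r : ℝ) (v : E³) : Fin 3 → ℤ :=
  fun i => ⌊v i / r⌋

/-- The velocity cell map is measurable. [folklore] -/
theorem Euclidean.measurable_coarseCell (r : ℝ) : Measurable (Euclidean.coarseCell r) := by
  refine measurable_pi_lambda _ fun i => ?_
  have h1 : Measurable fun v : E³ => v i :=
    (measurable_pi_apply (X := fun _ : Fin 3 => ℝ) i).comp (WithLp.measurable_ofLp 2 (Fin 3 → ℝ))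
  exact Int.measurable_floor.comp (h1.div_const r)

end Coarse

/-! ## Along a loaded-sphere trajectory: binary contacts, partners, flights, one-sided limits -/

namespace IsLoadedSphereTrajectory

variable {X : Type*} {N : ℕ} [TopologicalSpace X] {G : Geometry (Fin 3) X} {ε ξ ι : ℝ}
  {γ : ℝ → LoadedConfig N X}

/-- Two two-element finsets coincide iff their elements coincide up to order. [folklore] -/
private theorem pair_eq_pair_iff {i j a b : Fin N} :
    ({i, j} : Finset (Fin N)) = {a, b} ↔ i = a ∧ j = b ∨ i = b ∧ j = a := by
  rw [← Finset.coe_inj, Finset.coe_pair, Finset.coe_pair, Set.pair_eq_pair_iff]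

/-- On a loaded-sphere trajectory every bounded set of times carries finitely many contact times.
[folklore] -/
theorem finite_collisionTimes_inter_of_subset_Icc (h : IsLoadedSphereTrajectory G ε ξ ι N γ)
    {S : Set ℝ} {a b : ℝ} (hS : S ⊆ Icc a b) :
    (collisionTimes G ε (fun t => loadedProjection (γ t)) ∩ S).Finite :=
  (h.locFinite a b).subset (inter_subset_inter_right _ hS)

/-- **Binary contacts, ordered form**: if `(p, q)` is in contact at time `t`, every ordered contact
pair at time `t` is `(p, q)` or `(q, p)` (`IsLoadedSphereTrajectory.binary`). [folklore] -/
theorem eq_or_eq_of_mem_contactPairs (h : IsLoadedSphereTrajectory G ε ξ ι N γ) {t : ℝ}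
    {p q : Fin N} (hpq : (p, q) ∈ contactPairs G ε (loadedProjection (γ t))) {e : Fin N × Fin N}
    (he : e ∈ contactPairs G ε (loadedProjection (γ t))) : e = (p, q) ∨ e = (q, p) := by
  obtain ⟨hne, hc⟩ := mem_contactPairs.1 hpq
  obtain ⟨hne', hc'⟩ := mem_contactPairs.1 he
  obtain ⟨huniq, -⟩ := h.binary t p q hne hc
  rcases pair_eq_pair_iff.1 (huniq e.1 e.2 hne' hc') with ⟨h1, h2⟩ | ⟨h1, h2⟩
  · exact Or.inl (Prod.ext h1 h2)
  · exact Or.inr (Prod.ext h1 h2)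

/-- In a regular geometry the ordered contact pairs at a contact of `(p, q)` are exactly `(p, q)`
and `(q, p)`. [folklore] -/
theorem contactPairs_eq_pair (h : IsLoadedSphereTrajectory G ε ξ ι N γ)
    (hG : G.IsHardSphereRegular ε) {t : ℝ} {p q : Fin N}
    (hpq : (p, q) ∈ contactPairs G ε (loadedProjection (γ t))) :
    contactPairs G ε (loadedProjection (γ t)) = {(p, q), (q, p)} := by
  ext e
  rw [Finset.mem_insert, Finset.mem_singleton]
  refine ⟨h.eq_or_eq_of_mem_contactPairs hpq, ?_⟩
  rintro (rfl | rfl)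
  · exact hpq
  · exact (swap_mem_contactPairs_iff hG).2 hpq

/-- **Binary contacts and participation**: at a contact of the ordered pair `(i, j)` the
participating particles are exactly `i` and `j`. [folklore] -/
theorem participates_iff (h : IsLoadedSphereTrajectory G ε ξ ι N γ) {t : ℝ} {i j : Fin N}
    (hp : (i, j) ∈ contactPairs G ε (loadedProjection (γ t))) {k : Fin N} :
    Participates G ε (loadedProjection (γ t)) k ↔ k = i ∨ k = j := by
  constructor
  · rintro ⟨l, hkl | hlk⟩
    · rcases h.eq_or_eq_of_mem_contactPairs hp hkl with he | he
      · exact Or.inl (Prod.mk.inj he).1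
      · exact Or.inr (Prod.mk.inj he).1
    · rcases h.eq_or_eq_of_mem_contactPairs hp hlk with he | he
      · exact Or.inr (Prod.mk.inj he).2
      · exact Or.inl (Prod.mk.inj he).2
  · rintro (rfl | rfl)
    · exact ⟨j, Or.inl hp⟩
    · exact ⟨i, Or.inr hp⟩

/-- At a contact of the ordered pair `(i, j)`, the only particle colliding with `i` is `j`.
[folklore] -/
theorem eq_of_collide (h : IsLoadedSphereTrajectory G ε ξ ι N γ) {t : ℝ} {i j : Fin N}
    (hp : (i, j) ∈ contactPairs G ε (loadedProjection (γ t))) {l : Fin N}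
    (hl : Collide G ε (loadedProjection (γ t)) i l) : l = j := by
  have hij : i ≠ j := (mem_contactPairs.1 hp).1
  rcases hl with hil | hli
  · rcases h.eq_or_eq_of_mem_contactPairs hp hil with he | he
    · exact (Prod.mk.inj he).2
    · exact absurd (Prod.mk.inj he).1 hij
  · rcases h.eq_or_eq_of_mem_contactPairs hp hli with he | he
    · exact absurd (Prod.mk.inj he).2 hij
    · exact (Prod.mk.inj he).1

/-- **The partner is the partner**: at a contact of the ordered pair `(i, j)`,
`partner … i = j` and `partner … j = i`. [folklore] -/
theorem partner_eq (h : IsLoadedSphereTrajectory G ε ξ ι N γ) {t : ℝ} {i j : Fin N}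
    (hp : (i, j) ∈ contactPairs G ε (loadedProjection (γ t))) :
    partner G ε (loadedProjection (γ t)) i = j ∧ partner G ε (loadedProjection (γ t)) j = i := by
  refine ⟨h.eq_of_collide hp (collide_partner ⟨j, Or.inl hp⟩), ?_⟩
  have hl : Collide G ε (loadedProjection (γ t)) j (partner G ε (loadedProjection (γ t)) j) :=
    collide_partner ⟨i, Or.inr hp⟩
  have hij : i ≠ j := (mem_contactPairs.1 hp).1
  rcases hl with hjl | hlj
  · rcases h.eq_or_eq_of_mem_contactPairs hp hjl with he | he
    · exact absurd (Prod.mk.inj he).1.symm hij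
    · exact (Prod.mk.inj he).2
  · rcases h.eq_or_eq_of_mem_contactPairs hp hlj with he | he
    · exact (Prod.mk.inj he).1
    · exact absurd (Prod.mk.inj he).2 hij.symm

/-- On a loaded-sphere trajectory the contact times of a particle in a bounded window are
finitely many. [folklore] -/
theorem finite_collisionTimesOf_inter_Ioo (h : IsLoadedSphereTrajectory G ε ξ ι N γ) (k : Fin N)
    (a t : ℝ) : (collisionTimesOf G ε (fun t => loadedProjection (γ t)) k ∩ Ioo a t).Finite :=
  (h.locFinite a t).subset
    (inter_subset_inter (collisionTimesOf_subset _ k) Ioo_subset_Icc_self)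

/-- On a loaded-sphere trajectory the flight start of `k` at time `t` is `a` or a contact time of
`k` in `(a, t)`. [folklore] -/
theorem flightStart_mem (h : IsLoadedSphereTrajectory G ε ξ ι N γ) (a : ℝ) (k : Fin N) (t : ℝ) :
    flightStart G ε (fun t => loadedProjection (γ t)) a k t ∈
      insert a (collisionTimesOf G ε (fun t => loadedProjection (γ t)) k ∩ Ioo a t) :=
  FluidPDE.flightStart_mem (h.finite_collisionTimesOf_inter_Ioo k a t)

/-- The flight start is at least the initial time. [folklore] -/
theorem le_flightStart (h : IsLoadedSphereTrajectory G ε ξ ι N γ) (a : ℝ) (k : Fin N) (t : ℝ) :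
    a ≤ flightStart G ε (fun t => loadedProjection (γ t)) a k t :=
  FluidPDE.le_flightStart (h.finite_collisionTimesOf_inter_Ioo k a t)

/-- The flight start is before `t` (for `a < t`). [folklore] -/
theorem flightStart_lt (h : IsLoadedSphereTrajectory G ε ξ ι N γ) {a : ℝ} (k : Fin N) {t : ℝ}
    (hat : a < t) : flightStart G ε (fun t => loadedProjection (γ t)) a k t < t :=
  FluidPDE.flightStart_lt (h.finite_collisionTimesOf_inter_Ioo k a t) hat

/-- **The current flight is free**: particle `k` does not collide strictly between its flight start
and `t`. [folklore] -/
theorem not_participates_of_mem_Ioo_flightStart (h : IsLoadedSphereTrajectory G ε ξ ι N γ) {a : ℝ}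
    {k : Fin N} {t u : ℝ} (hu : u ∈ Ioo (flightStart G ε (fun t => loadedProjection (γ t)) a k t) t) :
    ¬ Participates G ε (loadedProjection (γ u)) k :=
  FluidPDE.not_participates_of_mem_Ioo_flightStart (h.finite_collisionTimesOf_inter_Ioo k a t) hu

/-- If particle `k` collides after `a`, its first contact time after `a` is the least element of its
contact times in `(a, ∞)`. [folklore] -/
theorem isLeast_nthCollisionTimeOf_zero (h : IsLoadedSphereTrajectory G ε ξ ι N γ) {a : ℝ}
    {k : Fin N} (hne : (collisionTimesOf G ε (fun t => loadedProjection (γ t)) k ∩ Ioi a).Nonempty) :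
    IsLeast (collisionTimesOf G ε (fun t => loadedProjection (γ t)) k ∩ Ioi a)
      (nthCollisionTimeOf G ε (fun t => loadedProjection (γ t)) a k 0) :=
  isLeast_nextTimeAfter (fun b => (h.locFinite a b).subset
    (inter_subset_inter (collisionTimesOf_subset _ k) Ioc_subset_Icc_self)) hne

/-- Every time has a contact-free open interval immediately to its left. [folklore] -/
theorem exists_Ioo_left_free (h : IsLoadedSphereTrajectory G ε ξ ι N γ) (t : ℝ) :
    ∃ s < t, ∀ τ ∈ Ioo s t, τ ∉ collisionTimes G ε (fun t => loadedProjection (γ t)) := by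
  classical
  set F : Finset ℝ :=
    insert (t - 1) (((h.locFinite (t - 1) t).toFinset).filter fun x => x < t) with hF
  have hne : F.Nonempty := ⟨t - 1, Finset.mem_insert_self _ _⟩
  refine ⟨F.max' hne, ?_, ?_⟩
  · rw [Finset.max'_lt_iff]
    intro y hy
    rcases Finset.mem_insert.1 hy with rfl | hy
    · linarith
    · exact (Finset.mem_filter.1 hy).2
  · intro τ hτ hcol
    have hτF : τ ∈ F := by
      refine Finset.mem_insert_of_mem (Finset.mem_filter.2 ⟨?_, hτ.2⟩)
      rw [Set.Finite.mem_toFinset]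
      have hlow : t - 1 ≤ F.max' hne := Finset.le_max' F (t - 1) (Finset.mem_insert_self _ _)
      exact ⟨hcol, by linarith [hτ.1], hτ.2.le⟩
    exact (not_lt.2 (Finset.le_max' F τ hτF)) hτ.1

/-- Every time has a contact-free open interval immediately to its right. [folklore] -/
theorem exists_Ioo_right_free (h : IsLoadedSphereTrajectory G ε ξ ι N γ) (t : ℝ) :
    ∃ u > t, ∀ τ ∈ Ioo t u, τ ∉ collisionTimes G ε (fun t => loadedProjection (γ t)) := by
  classical
  set F : Finset ℝ :=
    insert (t + 1) (((h.locFinite t (t + 1)).toFinset).filter fun x => t < x) with hF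
  have hne : F.Nonempty := ⟨t + 1, Finset.mem_insert_self _ _⟩
  refine ⟨F.min' hne, ?_, ?_⟩
  · rw [gt_iff_lt, Finset.lt_min'_iff]
    intro y hy
    rcases Finset.mem_insert.1 hy with rfl | hy
    · linarith
    · exact (Finset.mem_filter.1 hy).2
  · intro τ hτ hcol
    have hτF : τ ∈ F := by
      refine Finset.mem_insert_of_mem (Finset.mem_filter.2 ⟨?_, hτ.1⟩)
      rw [Set.Finite.mem_toFinset]
      have hup : F.min' hne ≤ t + 1 := Finset.min'_le F (t + 1) (Finset.mem_insert_self _ _)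
      exact ⟨hcol, hτ.1.le, by linarith [hτ.2]⟩
    exact (not_lt.2 (Finset.min'_le F τ hτF)) hτ.2

/-- On `[s, t)` with `(s, t)` contact-free, the trajectory is free motion from `γ s`. [folklore] -/
theorem eq_loadedFreeFlight_of_Ioo_free (h : IsLoadedSphereTrajectory G ε ξ ι N γ) {s t τ : ℝ}
    (hfree : ∀ σ ∈ Ioo s t, σ ∉ collisionTimes G ε (fun t => loadedProjection (γ t)))
    (hτ : τ ∈ Ico s t) : γ τ = loadedFreeFlight G ε ξ ι (τ - s) (γ s) :=
  h.free s τ hτ.1 fun σ hσ => hfree σ ⟨hσ.1, hσ.2.trans_lt hτ.2⟩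

/-- **Loaded-sphere trajectories are right-continuous** (continuous translations). [folklore] -/
theorem tendsto_nhdsGT (h : IsLoadedSphereTrajectory G ε ξ ι N γ)
    (hG : ∀ x : X, Continuous (G.translate x)) (t : ℝ) :
    Tendsto γ (𝓝[>] t) (𝓝 (γ t)) := by
  obtain ⟨u, htu, hfree⟩ := h.exists_Ioo_right_free t
  have hc : Continuous fun τ : ℝ => loadedFreeFlight G ε ξ ι (τ - t) (γ t) := by
    have hff := continuous_loadedFreeFlight_of_continuous_translate hG ε ξ ι (γ t)
    fun_prop
  have h1 : Tendsto (fun τ : ℝ => loadedFreeFlight G ε ξ ι (τ - t) (γ t)) (𝓝[>] t) (𝓝 (γ t)) := by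
    have := (hc.tendsto t).mono_left (nhdsWithin_le_nhds (s := Ioi t))
    simpa using this
  refine h1.congr' ?_
  filter_upwards [Ioo_mem_nhdsGT htu] with τ hτ
  exact (h.eq_loadedFreeFlight_of_Ioo_free hfree ⟨hτ.1.le, hτ.2⟩).symm

/-- Left limits: if `(s, t)` is contact-free then `γ τ → S_{t-s} (γ s)` as `τ ↑ t`. [folklore] -/
theorem tendsto_nhdsLT (h : IsLoadedSphereTrajectory G ε ξ ι N γ)
    (hG : ∀ x : X, Continuous (G.translate x)) {s t : ℝ} (hst : s < t)
    (hfree : ∀ σ ∈ Ioo s t, σ ∉ collisionTimes G ε (fun t => loadedProjection (γ t))) :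
    Tendsto γ (𝓝[<] t) (𝓝 (loadedFreeFlight G ε ξ ι (t - s) (γ s))) := by
  have hc : Continuous fun τ : ℝ => loadedFreeFlight G ε ξ ι (τ - s) (γ s) := by
    have hff := continuous_loadedFreeFlight_of_continuous_translate hG ε ξ ι (γ s)
    fun_prop
  refine ((hc.tendsto t).mono_left nhdsWithin_le_nhds).congr' ?_
  filter_upwards [Ioo_mem_nhdsLT hst] with τ hτ
  exact (h.eq_loadedFreeFlight_of_Ioo_free hfree ⟨hτ.1.le, hτ.2⟩).symm

/-- The left limit at `t` is the free-motion value from any `s < t` with `(s, t)` contact-free.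
[folklore] -/
theorem leftLim_eq_loadedFreeFlight [T2Space X] (h : IsLoadedSphereTrajectory G ε ξ ι N γ)
    (hG : ∀ x : X, Continuous (G.translate x)) {s t : ℝ} (hst : s < t)
    (hfree : ∀ σ ∈ Ioo s t, σ ∉ collisionTimes G ε (fun t => loadedProjection (γ t))) :
    leftLim γ t = loadedFreeFlight G ε ξ ι (t - s) (γ s) :=
  leftLim_eq_of_tendsto (h.tendsto_nhdsLT hG hst hfree)

/-- Loaded-sphere trajectories have left limits everywhere. [folklore] -/
theorem tendsto_leftLim [T2Space X] (h : IsLoadedSphereTrajectory G ε ξ ι N γ)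
    (hG : ∀ x : X, Continuous (G.translate x)) (t : ℝ) :
    Tendsto γ (𝓝[<] t) (𝓝 (leftLim γ t)) := by
  obtain ⟨s, hst, hfree⟩ := h.exists_Ioo_left_free t
  rw [h.leftLim_eq_loadedFreeFlight hG hst hfree]
  exact h.tendsto_nhdsLT hG hst hfree

/-- Away from contact times the left limit is the value. [folklore] -/
theorem leftLim_eq_of_not_mem [T2Space X] (h : IsLoadedSphereTrajectory G ε ξ ι N γ)
    (hG : ∀ x : X, Continuous (G.translate x)) {t : ℝ}
    (ht : t ∉ collisionTimes G ε (fun t => loadedProjection (γ t))) : leftLim γ t = γ t := by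
  obtain ⟨s, hst, hfree⟩ := h.exists_Ioo_left_free t
  rw [h.leftLim_eq_loadedFreeFlight hG hst hfree]
  refine (h.free s t hst.le fun σ hσ => ?_).symm
  rcases hσ.2.eq_or_lt with rfl | hlt
  · exact ht
  · exact hfree σ ⟨hσ.1, hlt⟩

/-- **The pre-collisional configuration by the involution**: at a contact of `(i, j)` the
trajectory tends, from the left, to `loadedCollide G ε ξ ι i j (γ t)` (from `binary` and
`loadedCollide_loadedCollide`; `ε ≠ 0`, `0 < ι`; no separation axiom needed). [folklore] -/
theorem tendsto_loadedCollide (h : IsLoadedSphereTrajectory G ε ξ ι N γ) (hε : ε ≠ 0) (hι : 0 < ι)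
    {t : ℝ} {i j : Fin N} (hij : i ≠ j)
    (hc : loadedProjection (γ t) ∈ contactSet G N ε i j) :
    Tendsto γ (𝓝[<] t) (𝓝 (loadedCollide G ε ξ ι i j (γ t))) := by
  obtain ⟨-, zl, hzl, -, heq⟩ := h.binary t i j hij hc
  have hi : ‖(zl i).2.1‖ = 1 := by
    rw [← loadedCollide_apply_dir (G := G) (ε := ε) (ξ := ξ) (ι := ι) (i := i) (j := j) zl i, ← heq]
    exact h.norm_dir_eq_one t i
  have hj : ‖(zl j).2.1‖ = 1 := by
    rw [← loadedCollide_apply_dir (G := G) (ε := ε) (ξ := ξ) (ι := ι) (i := i) (j := j) zl j, ← heq]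
    exact h.norm_dir_eq_one t j
  rwa [heq, loadedCollide_loadedCollide hε hι hij hi hj]

/-- The pre-collisional configuration `loadedCollide G ε ξ ι i j (γ t)` is incoming for the
colliding pair. [folklore] -/
theorem isLoadedIncoming_loadedCollide (h : IsLoadedSphereTrajectory G ε ξ ι N γ) (hε : ε ≠ 0)
    (hι : 0 < ι) {t : ℝ} {i j : Fin N} (hij : i ≠ j)
    (hc : loadedProjection (γ t) ∈ contactSet G N ε i j) :
    IsLoadedIncoming G ε ξ ι (loadedCollide G ε ξ ι i j (γ t)) i j := by
  obtain ⟨-, zl, -, hin, heq⟩ := h.binary t i j hij hc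
  have hi : ‖(zl i).2.1‖ = 1 := by
    rw [← loadedCollide_apply_dir (G := G) (ε := ε) (ξ := ξ) (ι := ι) (i := i) (j := j) zl i, ← heq]
    exact h.norm_dir_eq_one t i
  have hj : ‖(zl j).2.1‖ = 1 := by
    rw [← loadedCollide_apply_dir (G := G) (ε := ε) (ξ := ξ) (ι := ι) (i := i) (j := j) zl j, ← heq]
    exact h.norm_dir_eq_one t j
  rwa [heq, loadedCollide_loadedCollide hε hι hij hi hj]

/-- In a Hausdorff position space the left limit at a contact of `(i, j)` IS
`loadedCollide G ε ξ ι i j (γ t)`: the loaded `leftLim_eq_collidePair`. [folklore] -/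
theorem leftLim_eq_loadedCollide [T2Space X] (h : IsLoadedSphereTrajectory G ε ξ ι N γ)
    (hε : ε ≠ 0) (hι : 0 < ι) {t : ℝ} {i j : Fin N} (hij : i ≠ j)
    (hc : loadedProjection (γ t) ∈ contactSet G N ε i j) :
    leftLim γ t = loadedCollide G ε ξ ι i j (γ t) :=
  leftLim_eq_of_tendsto (h.tendsto_loadedCollide hε hι hij hc)

/-- **The recorded incoming data are the left limits**: at a contact of the ordered pair `(i, j)`
of a loaded-sphere trajectory in a Hausdorff position space,
`(ofConfig G ε ξ ι (γ t) t i j).preData = ((V_i(t⁻), V_j(t⁻)), (L_i(t⁻), L_j(t⁻)))`. [folklore] -/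
theorem ofConfig_preData_eq_leftLim [T2Space X] (h : IsLoadedSphereTrajectory G ε ξ ι N γ)
    (hε : ε ≠ 0) (hι : 0 < ι) {t : ℝ} {i j : Fin N}
    (hp : (i, j) ∈ contactPairs G ε (loadedProjection (γ t))) :
    (LoadedCollisionRecord.ofConfig G ε ξ ι (γ t) t i j).preData = loadedPairData (leftLim γ t) i j := by
  obtain ⟨hij, hc⟩ := mem_contactPairs.1 hp
  rw [h.leftLim_eq_loadedCollide hε hι hij hc]
  exact LoadedCollisionRecord.ofConfig_preData_eq_loadedPairData_loadedCollide hij (γ t) t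

/-- The recorded incoming data are incoming: the material contact points approach,
`0 < approachSpeed …`. [folklore] -/
theorem approachSpeed_ofConfig_preData_pos (h : IsLoadedSphereTrajectory G ε ξ ι N γ) (hε : ε ≠ 0)
    (hι : 0 < ι) {t : ℝ} {i j : Fin N} (hp : (i, j) ∈ contactPairs G ε (loadedProjection (γ t))) :
    0 < approachSpeed ε ξ ι (γ t i).2.1 (γ t j).2.1 (loadedNormal G (γ t) i j)
      (LoadedCollisionRecord.ofConfig G ε ξ ι (γ t) t i j).preData := by
  obtain ⟨hij, hc⟩ := mem_contactPairs.1 hp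
  have hin := h.isLoadedIncoming_loadedCollide hε hι hij hc
  rw [LoadedCollisionRecord.ofConfig_preData_eq_loadedPairData_loadedCollide hij (γ t) t]
  simpa only [IsLoadedIncoming, loadedCollide_apply_dir, loadedNormal_loadedCollide] using hin

end IsLoadedSphereTrajectory

/-! ## Along the loaded-sphere flow: the `n`-th contact of a particle, its phases, its coarse past -/

namespace LoadedSphereFlow

variable {X : Type*} [MeasureSpace X] [TopologicalSpace X] {N : ℕ} {G : Geometry (Fin 3) X}
  {ε ξ ι : ℝ}

open scoped Classical in
/-- The **time of the `n`-th contact of particle `i`** after time `0` along the orbit of `z`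
(`n = 0` is the first): the hard-sphere enumerator `nthCollisionTimeOf` of the PROJECTED orbit
`t ↦ loadedProjection (Ψ_t z)` for good `z` (junk beyond the last contact, as there); the junk value
`0` off the good set `Ψ.good`, where the flow itself is junk (this single cut-off makes every map
below a globally measurable function of `z`). [folklore] -/
def nthCollisionTimeOf (Ψ : LoadedSphereFlow G ε ξ ι N) (i : Fin N) (n : ℕ) (z : LoadedConfig N X) :
    ℝ :=
  if z ∈ Ψ.good then FluidPDE.nthCollisionTimeOf G ε (fun t => loadedProjection (Ψ.flow t z)) 0 i n
  else 0

/-- The (post-collisional, right-continuous) **loaded configuration at the `n`-th contact of `i`**.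
[folklore] -/
def nthContactConfig (Ψ : LoadedSphereFlow G ε ξ ι N) (i : Fin N) (n : ℕ) (z : LoadedConfig N X) :
    LoadedConfig N X :=
  Ψ.flow (Ψ.nthCollisionTimeOf i n z) z

/-- The **partner of `i` in its `n`-th contact** along the orbit of `z` (`partner` of the projected
configuration; junk value `i` if `i` touches nobody then). [folklore] -/
def nthPartnerOf (Ψ : LoadedSphereFlow G ε ξ ι N) (i : Fin N) (n : ℕ) (z : LoadedConfig N X) :
    Fin N :=
  partner G ε (loadedProjection (Ψ.nthContactConfig i n z)) i

/-- The **start of the flight of `i`** ending in its `n`-th contact: the last contact time of `i`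
in `(0, τ)`, `τ` the `n`-th contact time, else `0` (`flightStart` of the projected orbit). [folklore] -/
def flightStartOf (Ψ : LoadedSphereFlow G ε ξ ι N) (i : Fin N) (n : ℕ) (z : LoadedConfig N X) : ℝ :=
  flightStart G ε (fun t => loadedProjection (Ψ.flow t z)) 0 i (Ψ.nthCollisionTimeOf i n z)

/-- The **start of the flight of the partner** of `i` ending in the `n`-th contact of `i`. [folklore] -/
def partnerFlightStartOf (Ψ : LoadedSphereFlow G ε ξ ι N) (i : Fin N) (n : ℕ)
    (z : LoadedConfig N X) : ℝ :=
  flightStart G ε (fun t => loadedProjection (Ψ.flow t z)) 0 (Ψ.nthPartnerOf i n z)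
    (Ψ.nthCollisionTimeOf i n z)

/-- The **contact phases** of the `n`-th contact of `i`: the load directions `(a_i, a_j)` of `i` and
of its partner `j` at the contact instant (load directions are continuous in time, so the value at
the contact instant is unambiguous). [folklore] -/
def nthContactPhases (Ψ : LoadedSphereFlow G ε ξ ι N) (i : Fin N) (n : ℕ) (z : LoadedConfig N X) :
    E³ × E³ :=
  ((Ψ.nthContactConfig i n z i).2.1, (Ψ.nthContactConfig i n z (Ψ.nthPartnerOf i n z)).2.1)

/-- The **contact normal** of the `n`-th contact of `i`: the unit normal from the geometric centre
of `i` to that of its partner (`loadedNormal`). [folklore] -/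
def nthContactNormal (Ψ : LoadedSphereFlow G ε ξ ι N) (i : Fin N) (n : ℕ) (z : LoadedConfig N X) :
    E³ :=
  loadedNormal G (Ψ.nthContactConfig i n z) i (Ψ.nthPartnerOf i n z)

/-- The **outgoing pair data** `((V_i⁺, V_j⁺), (L_i⁺, L_j⁺))` of the `n`-th contact of `i` (the
data of the right-continuous value). [folklore] -/
def nthPostData (Ψ : LoadedSphereFlow G ε ξ ι N) (i : Fin N) (n : ℕ) (z : LoadedConfig N X) :
    (E³ × E³) × (E³ × E³) :=
  loadedPairData (Ψ.nthContactConfig i n z) i (Ψ.nthPartnerOf i n z)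

/-- The **incoming pair data** `((V_i⁻, V_j⁻), (L_i⁻, L_j⁻))` of the `n`-th contact of `i`,
recovered from the post-collisional value by the involution `loadedPostData` (they are the data of
the left limit, `nthPreData_eq_leftLim`). [folklore] -/
def nthPreData (Ψ : LoadedSphereFlow G ε ξ ι N) (i : Fin N) (n : ℕ) (z : LoadedConfig N X) :
    (E³ × E³) × (E³ × E³) :=
  loadedPostData G ε ξ ι (Ψ.nthContactConfig i n z) i (Ψ.nthPartnerOf i n z)

/-- The unit **incoming relative mass-centre velocity** `ĝ = (V_i⁻ - V_j⁻)/|V_i⁻ - V_j⁻|` of the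
`n`-th contact of `i` (junk value `0` if the two incoming velocities coincide). [folklore] -/
def nthInDir (Ψ : LoadedSphereFlow G ε ξ ι N) (i : Fin N) (n : ℕ) (z : LoadedConfig N X) : E³ :=
  ‖(Ψ.nthPreData i n z).1.1 - (Ψ.nthPreData i n z).1.2‖⁻¹ •
    ((Ψ.nthPreData i n z).1.1 - (Ψ.nthPreData i n z).1.2)

/-- The **record of the `n`-th contact of `i`** along the orbit of `z` (ordered pair
`(i, partner)`, `LoadedCollisionRecord.ofConfig` of the configuration at the contact time). [folklore] -/
def nthRecordOf (Ψ : LoadedSphereFlow G ε ξ ι N) (i : Fin N) (n : ℕ) (z : LoadedConfig N X) :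
    LoadedCollisionRecord X N :=
  LoadedCollisionRecord.ofConfig G ε ξ ι (Ψ.nthContactConfig i n z) (Ψ.nthCollisionTimeOf i n z) i
    (Ψ.nthPartnerOf i n z)

/-- The **coarse past of the `n`-th contact of `i`**, as a function of the initial datum `z`: the
coarse-grained loaded configurations (`loadedCoarseConfig q qv`: geometric centres through `q`,
mass-centre velocities, load directions and angular momenta through `qv`) of ALL particles at the
starts of the free flights of `i` and of its partner that end in this contact. [folklore] -/
def coarsePastOf {C Cv : Type*} (Ψ : LoadedSphereFlow G ε ξ ι N) (q : X → C) (qv : E³ → Cv)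
    (i : Fin N) (n : ℕ) (z : LoadedConfig N X) :
    (Fin N → (C × Cv) × (Cv × Cv)) × (Fin N → (C × Cv) × (Cv × Cv)) :=
  (loadedCoarseConfig q qv (Ψ.flow (Ψ.flightStartOf i n z) z),
    loadedCoarseConfig q qv (Ψ.flow (Ψ.partnerFlightStartOf i n z) z))

/-- The **σ-algebra of the coarse past** of the `n`-th contact of `i`: the σ-algebra on initial data
generated by `Ψ.coarsePastOf q qv i n` (`MeasurableSpace.comap`); conditional expectations
`MeasureTheory.condExp` and conditional laws `ProbabilityTheory.condDistrib` given the coarse past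
refer to it. [folklore] -/
abbrev coarsePastSigma {C Cv : Type*} [MeasurableSpace C] [MeasurableSpace Cv]
    (Ψ : LoadedSphereFlow G ε ξ ι N) (q : X → C) (qv : E³ → Cv) (i : Fin N) (n : ℕ) :
    MeasurableSpace (LoadedConfig N X) :=
  MeasurableSpace.comap (Ψ.coarsePastOf q qv i n) inferInstance

open scoped Classical in
/-- The **exact initial data of the other particles**: `k ↦ z_k` for every particle `k` other than
`i` and its `n`-th partner, the colliding pair being masked by `Sum.inl ()` (so that the generated
σ-algebra is: the partner, and the full initial data of everybody else). [folklore] -/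
def othersInitialOf (Ψ : LoadedSphereFlow G ε ξ ι N) (i : Fin N) (n : ℕ) (z : LoadedConfig N X) :
    Fin N → Unit ⊕ ((X × E³) × (E³ × E³)) :=
  fun k => if k = i ∨ k = Ψ.nthPartnerOf i n z then Sum.inl () else Sum.inr (z k)

/-- The **σ-algebra of the coarse past and the others' data** of the `n`-th contact of `i`:
generated by the coarse past `Ψ.coarsePastOf q qv i n` TOGETHER WITH the exact initial data of
every particle other than `i` and its `n`-th partner (`Ψ.othersInitialOf i n`) — coarse knowledge
of the colliding pair, exact knowledge of the others; the conditioning of `PhaseFreshness`. [folklore] -/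
abbrev coarsePastOthersSigma {C Cv : Type*} [MeasurableSpace C] [MeasurableSpace Cv]
    (Ψ : LoadedSphereFlow G ε ξ ι N) (q : X → C) (qv : E³ → Cv) (i : Fin N) (n : ℕ) :
    MeasurableSpace (LoadedConfig N X) :=
  Ψ.coarsePastSigma q qv i n ⊔ MeasurableSpace.comap (Ψ.othersInitialOf i n) inferInstance

/-- **Re-contact**: the `n`-th contact of `i` (`n ≥ 1`) is with the same partner as its
`(n-1)`-st. [folklore] -/
def IsRecontact (Ψ : LoadedSphereFlow G ε ξ ι N) (i : Fin N) (n : ℕ) (z : LoadedConfig N X) : Prop :=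
  n ≠ 0 ∧ Ψ.nthPartnerOf i n z = Ψ.nthPartnerOf i (n - 1) z

/-- **Short flight**: the free flight of `i` or the free flight of its partner ending in the `n`-th
contact of `i` is shorter than `s` (`PhaseFreshness` uses `s = ε√ι/ξ`). [folklore] -/
def IsShortFlight (Ψ : LoadedSphereFlow G ε ξ ι N) (i : Fin N) (n : ℕ) (z : LoadedConfig N X)
    (s : ℝ) : Prop :=
  Ψ.nthCollisionTimeOf i n z - Ψ.flightStartOf i n z < s ∨
    Ψ.nthCollisionTimeOf i n z - Ψ.partnerFlightStartOf i n z < s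

/-- **Near-grazing contact**: `|⟪ĝ, n⟫| < δ` for the unit incoming relative mass-centre velocity `ĝ`
and the contact normal `n` of the `n`-th contact of `i`. [folklore] -/
def IsGrazing (Ψ : LoadedSphereFlow G ε ξ ι N) (i : Fin N) (n : ℕ) (z : LoadedConfig N X)
    (δ : ℝ) : Prop :=
  |⟪Ψ.nthInDir i n z, Ψ.nthContactNormal i n z⟫_ℝ| < δ

/-- **Near-polar contact**: `|⟪a, n⟫| > 1 - δ` for the contact normal `n` and one of the two contact
phases `a ∈ {a_i, a_j}` of the `n`-th contact of `i` (the load of one partner points at the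
contact point or away from it). [folklore] -/
def IsPolar (Ψ : LoadedSphereFlow G ε ξ ι N) (i : Fin N) (n : ℕ) (z : LoadedConfig N X)
    (δ : ℝ) : Prop :=
  1 - δ < |⟪(Ψ.nthContactPhases i n z).1, Ψ.nthContactNormal i n z⟫_ℝ| ∨
    1 - δ < |⟪(Ψ.nthContactPhases i n z).2, Ψ.nthContactNormal i n z⟫_ℝ|

/-- The **loaded collision pair sum** along the orbit of `z`: `Σ` over the contact times in `S` and
the ordered contact pairs of the summand, which sees the time, the current (post-collisional)
loaded configuration and the ordered pair (`collisionPairSum` of the projected orbit; meaningful on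
`Ψ.good`). [folklore] -/
def collisionPairSum {M : Type*} [AddCommMonoid M] (Ψ : LoadedSphereFlow G ε ξ ι N) (S : Set ℝ)
    (g : ℝ → LoadedConfig N X → Fin N → Fin N → M) (z : LoadedConfig N X) : M :=
  FluidPDE.collisionPairSum G ε (fun t => loadedProjection (Ψ.flow t z)) S
    fun t i j => g t (Ψ.flow t z) i j

variable (Ψ : LoadedSphereFlow G ε ξ ι N)

/-! ### Unfolding lemmas -/

/-- On the good set the `n`-th contact time is the hard-sphere enumerator of the projected orbit.
[folklore] -/
theorem nthCollisionTimeOf_eq {z : LoadedConfig N X} (hz : z ∈ Ψ.good) (i : Fin N) (n : ℕ) :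
    Ψ.nthCollisionTimeOf i n z =
      FluidPDE.nthCollisionTimeOf G ε (fun t => loadedProjection (Ψ.flow t z)) 0 i n :=
  if_pos hz

/-- Off the good set the `n`-th contact time is the junk value `0`. [folklore] -/
theorem nthCollisionTimeOf_of_not_mem {z : LoadedConfig N X} (hz : z ∉ Ψ.good) (i : Fin N) (n : ℕ) :
    Ψ.nthCollisionTimeOf i n z = 0 :=
  if_neg hz

/-- The first contact time of `i` on the good set is the next contact time of `i` after `0`.
[folklore] -/
theorem nthCollisionTimeOf_zero {z : LoadedConfig N X} (hz : z ∈ Ψ.good) (i : Fin N) :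
    Ψ.nthCollisionTimeOf i 0 z =
      nextTimeAfter (collisionTimesOf G ε (fun t => loadedProjection (Ψ.flow t z)) i) 0 := by
  rw [Ψ.nthCollisionTimeOf_eq hz, FluidPDE.nthCollisionTimeOf, nthTimeAfter_zero]

/-- The recursion of the enumeration on the good set: the `(n+1)`-st contact time of `i` is the
next contact time of `i` after the `n`-th. [folklore] -/
theorem nthCollisionTimeOf_succ {z : LoadedConfig N X} (hz : z ∈ Ψ.good) (i : Fin N) (n : ℕ) :
    Ψ.nthCollisionTimeOf i (n + 1) z =
      nextTimeAfter (collisionTimesOf G ε (fun t => loadedProjection (Ψ.flow t z)) i)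
        (Ψ.nthCollisionTimeOf i n z) := by
  rw [Ψ.nthCollisionTimeOf_eq hz, Ψ.nthCollisionTimeOf_eq hz, FluidPDE.nthCollisionTimeOf,
    FluidPDE.nthCollisionTimeOf, nthTimeAfter_succ]

/-- Unfolding lemma for the configuration at the `n`-th contact. [folklore] -/
theorem nthContactConfig_eq (i : Fin N) (n : ℕ) (z : LoadedConfig N X) :
    Ψ.nthContactConfig i n z = Ψ.flow (Ψ.nthCollisionTimeOf i n z) z :=
  rfl

/-- Off the good set the configuration at the `n`-th contact is the time-`0` value. [folklore] -/
theorem nthContactConfig_of_not_mem {z : LoadedConfig N X} (hz : z ∉ Ψ.good) (i : Fin N) (n : ℕ) :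
    Ψ.nthContactConfig i n z = Ψ.flow 0 z := by
  rw [nthContactConfig_eq, Ψ.nthCollisionTimeOf_of_not_mem hz]

/-- Unfolding lemma for the `n`-th partner. [folklore] -/
theorem nthPartnerOf_eq_partner (i : Fin N) (n : ℕ) (z : LoadedConfig N X) :
    Ψ.nthPartnerOf i n z = partner G ε (loadedProjection (Ψ.nthContactConfig i n z)) i :=
  rfl

/-- Unfolding lemma for the flight start of `i`. [folklore] -/
theorem flightStartOf_eq (i : Fin N) (n : ℕ) (z : LoadedConfig N X) :
    Ψ.flightStartOf i n z =
      flightStart G ε (fun t => loadedProjection (Ψ.flow t z)) 0 i (Ψ.nthCollisionTimeOf i n z) :=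
  rfl

/-- Unfolding lemma for the flight start of the partner. [folklore] -/
theorem partnerFlightStartOf_eq (i : Fin N) (n : ℕ) (z : LoadedConfig N X) :
    Ψ.partnerFlightStartOf i n z =
      flightStart G ε (fun t => loadedProjection (Ψ.flow t z)) 0 (Ψ.nthPartnerOf i n z)
        (Ψ.nthCollisionTimeOf i n z) :=
  rfl

omit [MeasureSpace X] [TopologicalSpace X] in
/-- A flight start at the (junk) time `0` is `0`: so off the good set both flight starts vanish.
[folklore] -/
theorem flightStart_zero_right (γ : ℝ → Config N (Fin 3) X) (k : Fin N) :
    flightStart G ε γ 0 k 0 = 0 := by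
  rw [flightStart, Ioo_self, inter_empty, insert_empty_eq, csSup_singleton]

/-- Off the good set the flight start of `i` is `0`. [folklore] -/
theorem flightStartOf_of_not_mem {z : LoadedConfig N X} (hz : z ∉ Ψ.good) (i : Fin N) (n : ℕ) :
    Ψ.flightStartOf i n z = 0 := by
  rw [flightStartOf_eq, Ψ.nthCollisionTimeOf_of_not_mem hz, flightStart_zero_right]

/-- Off the good set the flight start of the partner is `0`. [folklore] -/
theorem partnerFlightStartOf_of_not_mem {z : LoadedConfig N X} (hz : z ∉ Ψ.good) (i : Fin N)
    (n : ℕ) : Ψ.partnerFlightStartOf i n z = 0 := by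
  rw [partnerFlightStartOf_eq, Ψ.nthCollisionTimeOf_of_not_mem hz, flightStart_zero_right]

/-- **The unfolding lemma of the contact phases**: `Ψ.nthContactPhases i n z = (a_i(τ), a_j(τ))`
with `τ` the `n`-th contact time of `i` and `j` its partner. [folklore] -/
theorem nthContactPhases_eq (i : Fin N) (n : ℕ) (z : LoadedConfig N X) :
    Ψ.nthContactPhases i n z =
      ((Ψ.flow (Ψ.nthCollisionTimeOf i n z) z i).2.1,
        (Ψ.flow (Ψ.nthCollisionTimeOf i n z) z (Ψ.nthPartnerOf i n z)).2.1) :=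
  rfl

/-- Unfolding lemma for the contact normal. [folklore] -/
theorem nthContactNormal_eq (i : Fin N) (n : ℕ) (z : LoadedConfig N X) :
    Ψ.nthContactNormal i n z =
      loadedNormal G (Ψ.flow (Ψ.nthCollisionTimeOf i n z) z) i (Ψ.nthPartnerOf i n z) :=
  rfl

/-- Unfolding lemma for the outgoing data. [folklore] -/
theorem nthPostData_eq (i : Fin N) (n : ℕ) (z : LoadedConfig N X) :
    Ψ.nthPostData i n z =
      loadedPairData (Ψ.flow (Ψ.nthCollisionTimeOf i n z) z) i (Ψ.nthPartnerOf i n z) :=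
  rfl

/-- Unfolding lemma for the incoming data: the impact map applied to the outgoing data, with the
phases and the normal of the contact. [folklore] -/
theorem nthPreData_eq (i : Fin N) (n : ℕ) (z : LoadedConfig N X) :
    Ψ.nthPreData i n z =
      loadedImpact ε ξ ι (Ψ.nthContactPhases i n z).1 (Ψ.nthContactPhases i n z).2
        (Ψ.nthContactNormal i n z) (Ψ.nthPostData i n z) :=
  rfl

/-- The fields of the `n`-th record. [folklore] -/
theorem nthRecordOf_eq (i : Fin N) (n : ℕ) (z : LoadedConfig N X) :
    Ψ.nthRecordOf i n z =
      ⟨Ψ.nthCollisionTimeOf i n z, i, Ψ.nthPartnerOf i n z, (Ψ.nthContactConfig i n z i).1.1,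
        (Ψ.nthContactConfig i n z (Ψ.nthPartnerOf i n z)).1.1, Ψ.nthContactNormal i n z,
        Ψ.nthContactPhases i n z, Ψ.nthPreData i n z, Ψ.nthPostData i n z⟩ :=
  rfl

/-- The incoming direction of the `n`-th record is `Ψ.nthInDir`. [folklore] -/
theorem nthRecordOf_inDir (i : Fin N) (n : ℕ) (z : LoadedConfig N X) :
    (Ψ.nthRecordOf i n z).inDir = Ψ.nthInDir i n z :=
  rfl

/-- Unfolding lemma for the coarse past. [folklore] -/
theorem coarsePastOf_eq {C Cv : Type*} (q : X → C) (qv : E³ → Cv) (i : Fin N) (n : ℕ)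
    (z : LoadedConfig N X) :
    Ψ.coarsePastOf q qv i n z =
      (loadedCoarseConfig q qv (Ψ.flow (Ψ.flightStartOf i n z) z),
        loadedCoarseConfig q qv (Ψ.flow (Ψ.partnerFlightStartOf i n z) z)) :=
  rfl

/-- Unfolding lemma for the others' initial data. [folklore] -/
theorem othersInitialOf_apply (i : Fin N) (n : ℕ) (z : LoadedConfig N X) (k : Fin N) :
    Ψ.othersInitialOf i n z k =
      if k = i ∨ k = Ψ.nthPartnerOf i n z then Sum.inl () else Sum.inr (z k) := by
  rw [othersInitialOf]

/-- The colliding particle itself is masked in the others' data. [folklore] -/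
theorem othersInitialOf_apply_self (i : Fin N) (n : ℕ) (z : LoadedConfig N X) :
    Ψ.othersInitialOf i n z i = Sum.inl () := by
  rw [othersInitialOf_apply, if_pos (Or.inl rfl)]

/-- The partner is masked in the others' data. [folklore] -/
theorem othersInitialOf_apply_partner (i : Fin N) (n : ℕ) (z : LoadedConfig N X) :
    Ψ.othersInitialOf i n z (Ψ.nthPartnerOf i n z) = Sum.inl () := by
  rw [othersInitialOf_apply, if_pos (Or.inr rfl)]

/-- Every other particle shows its exact initial datum. [folklore] -/
theorem othersInitialOf_apply_of_ne {i : Fin N} {n : ℕ} {z : LoadedConfig N X} {k : Fin N}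
    (hki : k ≠ i) (hkp : k ≠ Ψ.nthPartnerOf i n z) : Ψ.othersInitialOf i n z k = Sum.inr (z k) := by
  rw [othersInitialOf_apply, if_neg (not_or.2 ⟨hki, hkp⟩)]

/-- Unfolding lemma for the loaded collision pair sum. [folklore] -/
theorem collisionPairSum_eq {M : Type*} [AddCommMonoid M] (S : Set ℝ)
    (g : ℝ → LoadedConfig N X → Fin N → Fin N → M) (z : LoadedConfig N X) :
    Ψ.collisionPairSum S g z = FluidPDE.collisionPairSum G ε (fun t => loadedProjection (Ψ.flow t z)) S
      fun t i j => g t (Ψ.flow t z) i j :=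
  rfl

/-! ### Existence of the `n`-th contact -/

/-- The **`n`-th contact of `i` exists** along the orbit of `z`: `z` is good and the enumeration is
proper up to `n`, `0 < τ₀ < τ₁ < ⋯ < τₙ` (`τₘ = Ψ.nthCollisionTimeOf i m z`). On the good set this
says exactly that `i` has at least `n + 1` contacts after time `0`, `τ₀, …, τₙ` being the first ones
(`HasNthContact.mem_collisionTimesOf`, `nthCollisionTimeOf_lt_succ_iff`); past the last contact the
enumerator takes junk values and this predicate is false. [folklore] -/
def HasNthContact (Ψ : LoadedSphereFlow G ε ξ ι N) (i : Fin N) (n : ℕ) (z : LoadedConfig N X) :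
    Prop :=
  z ∈ Ψ.good ∧ 0 < Ψ.nthCollisionTimeOf i 0 z ∧
    ∀ m < n, Ψ.nthCollisionTimeOf i m z < Ψ.nthCollisionTimeOf i (m + 1) z

/-- On the good set the contact times of a particle are finite on bounded intervals. [folklore] -/
theorem finite_collisionTimesOf_inter_Ioc {z : LoadedConfig N X} (hz : z ∈ Ψ.good) (i : Fin N)
    (x b : ℝ) : (collisionTimesOf G ε (fun t => loadedProjection (Ψ.flow t z)) i ∩ Ioc x b).Finite :=
  ((Ψ.isTrajectory z hz).locFinite x b).subset
    (inter_subset_inter (collisionTimesOf_subset _ i) Ioc_subset_Icc_self)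

/-- If `i` has a contact after `0`, its first contact time is the least such. [folklore] -/
theorem isLeast_nthCollisionTimeOf_zero {z : LoadedConfig N X} (hz : z ∈ Ψ.good) {i : Fin N}
    (hne : (collisionTimesOf G ε (fun t => loadedProjection (Ψ.flow t z)) i ∩ Ioi 0).Nonempty) :
    IsLeast (collisionTimesOf G ε (fun t => loadedProjection (Ψ.flow t z)) i ∩ Ioi 0)
      (Ψ.nthCollisionTimeOf i 0 z) := by
  rw [Ψ.nthCollisionTimeOf_zero hz]
  exact isLeast_nextTimeAfter (Ψ.finite_collisionTimesOf_inter_Ioc hz i 0) hne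

/-- If `i` has a contact after its `n`-th contact time, the `(n+1)`-st contact time is the least
such. [folklore] -/
theorem isLeast_nthCollisionTimeOf_succ {z : LoadedConfig N X} (hz : z ∈ Ψ.good) {i : Fin N}
    {n : ℕ} (hne : (collisionTimesOf G ε (fun t => loadedProjection (Ψ.flow t z)) i ∩
      Ioi (Ψ.nthCollisionTimeOf i n z)).Nonempty) :
    IsLeast (collisionTimesOf G ε (fun t => loadedProjection (Ψ.flow t z)) i ∩
      Ioi (Ψ.nthCollisionTimeOf i n z)) (Ψ.nthCollisionTimeOf i (n + 1) z) := by
  rw [Ψ.nthCollisionTimeOf_succ hz]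
  exact isLeast_nextTimeAfter (Ψ.finite_collisionTimesOf_inter_Ioc hz i _) hne

/-- Contact times along the flow are nonnegative (junk values included). [folklore] -/
theorem nthCollisionTimeOf_nonneg (i : Fin N) (n : ℕ) (z : LoadedConfig N X) :
    0 ≤ Ψ.nthCollisionTimeOf i n z := by
  by_cases hz : z ∈ Ψ.good
  · induction n with
    | zero =>
      by_cases hne : (collisionTimesOf G ε (fun t => loadedProjection (Ψ.flow t z)) i ∩ Ioi 0).Nonempty
      · exact le_of_lt (Ψ.isLeast_nthCollisionTimeOf_zero hz hne).1.2
      · rw [Ψ.nthCollisionTimeOf_zero hz, nextTimeAfter_of_eq_empty (not_nonempty_iff_eq_empty.1 hne)]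
    | succ n ih =>
      by_cases hne : (collisionTimesOf G ε (fun t => loadedProjection (Ψ.flow t z)) i ∩
          Ioi (Ψ.nthCollisionTimeOf i n z)).Nonempty
      · exact ih.trans (le_of_lt (Ψ.isLeast_nthCollisionTimeOf_succ hz hne).1.2)
      · rw [Ψ.nthCollisionTimeOf_succ hz, nextTimeAfter_of_eq_empty (not_nonempty_iff_eq_empty.1 hne)]
  · rw [Ψ.nthCollisionTimeOf_of_not_mem hz]

/-- On the good set, `0 < τ₀` iff `i` has a contact after time `0`. [folklore] -/
theorem nthCollisionTimeOf_zero_pos_iff {z : LoadedConfig N X} (hz : z ∈ Ψ.good) {i : Fin N} :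
    0 < Ψ.nthCollisionTimeOf i 0 z ↔
      (collisionTimesOf G ε (fun t => loadedProjection (Ψ.flow t z)) i ∩ Ioi 0).Nonempty := by
  refine ⟨fun h => ?_, fun hne => (Ψ.isLeast_nthCollisionTimeOf_zero hz hne).1.2⟩
  by_contra hne
  rw [Ψ.nthCollisionTimeOf_zero hz, nextTimeAfter_of_eq_empty (not_nonempty_iff_eq_empty.1 hne)] at h
  exact lt_irrefl _ h

/-- On the good set, `τₙ < τₙ₊₁` iff `i` has a contact after `τₙ`. [folklore] -/
theorem nthCollisionTimeOf_lt_succ_iff {z : LoadedConfig N X} (hz : z ∈ Ψ.good) {i : Fin N} {n : ℕ} :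
    Ψ.nthCollisionTimeOf i n z < Ψ.nthCollisionTimeOf i (n + 1) z ↔
      (collisionTimesOf G ε (fun t => loadedProjection (Ψ.flow t z)) i ∩
        Ioi (Ψ.nthCollisionTimeOf i n z)).Nonempty := by
  refine ⟨fun h => ?_, fun hne => (Ψ.isLeast_nthCollisionTimeOf_succ hz hne).1.2⟩
  by_contra hne
  rw [Ψ.nthCollisionTimeOf_succ hz, nextTimeAfter_of_eq_empty (not_nonempty_iff_eq_empty.1 hne)] at h
  exact (not_lt.2 (Ψ.nthCollisionTimeOf_nonneg i n z)) h

namespace HasNthContact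

variable {Ψ} {i : Fin N} {n : ℕ} {z : LoadedConfig N X}

/-- An existing contact is along a good orbit. [folklore] -/
theorem mem_good (h : Ψ.HasNthContact i n z) : z ∈ Ψ.good := h.1

/-- Earlier contacts exist too. [folklore] -/
theorem mono (h : Ψ.HasNthContact i n z) {m : ℕ} (hmn : m ≤ n) : Ψ.HasNthContact i m z :=
  ⟨h.1, h.2.1, fun k hk => h.2.2 k (lt_of_lt_of_le hk hmn)⟩

/-- The enumeration of existing contacts is strictly increasing. [folklore] -/
theorem strictMonoOn (h : Ψ.HasNthContact i n z) :
    StrictMonoOn (fun m => Ψ.nthCollisionTimeOf i m z) (Iic n) := by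
  intro a ha b hb hab
  induction b with
  | zero => exact absurd hab (Nat.not_lt_zero a)
  | succ b ih =>
    have hb' : b < n := Nat.lt_of_succ_le hb
    rcases Nat.lt_succ_iff_lt_or_eq.1 hab with hlt | rfl
    · exact (ih (mem_Iic.2 hb'.le) hlt).trans (h.2.2 b hb')
    · exact h.2.2 a hb'

/-- **An existing contact is a contact**: `τₙ` is a contact time of `i`, after time `0`. [folklore] -/
theorem mem_collisionTimesOf (h : Ψ.HasNthContact i n z) :
    Ψ.nthCollisionTimeOf i n z ∈
      collisionTimesOf G ε (fun t => loadedProjection (Ψ.flow t z)) i ∩ Ioi 0 := by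
  induction n with
  | zero => exact (Ψ.isLeast_nthCollisionTimeOf_zero h.1 ((Ψ.nthCollisionTimeOf_zero_pos_iff h.1).1 h.2.1)).1
  | succ n ih =>
    have h' : Ψ.HasNthContact i n z := h.mono (Nat.le_succ n)
    have hlt := h.2.2 n (Nat.lt_succ_self n)
    have hmem := (Ψ.isLeast_nthCollisionTimeOf_succ h.1
      ((Ψ.nthCollisionTimeOf_lt_succ_iff h.1).1 hlt)).1
    exact ⟨hmem.1, mem_Ioi.2 (lt_trans (mem_Ioi.1 (ih h').2) (mem_Ioi.1 hmem.2))⟩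

/-- An existing contact happens at a positive time. [folklore] -/
theorem pos (h : Ψ.HasNthContact i n z) : 0 < Ψ.nthCollisionTimeOf i n z :=
  h.mem_collisionTimesOf.2

/-- At an existing contact `i` participates. [folklore] -/
theorem participates (h : Ψ.HasNthContact i n z) :
    Participates G ε (loadedProjection (Ψ.nthContactConfig i n z)) i :=
  h.mem_collisionTimesOf.1

/-- At an existing contact `i` collides with its partner. [folklore] -/
theorem collide_nthPartnerOf (h : Ψ.HasNthContact i n z) :
    Collide G ε (loadedProjection (Ψ.nthContactConfig i n z)) i (Ψ.nthPartnerOf i n z) :=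
  collide_partner h.participates

/-- The partner of an existing contact is another particle. [folklore] -/
theorem nthPartnerOf_ne (h : Ψ.HasNthContact i n z) : Ψ.nthPartnerOf i n z ≠ i :=
  fun he => h.collide_nthPartnerOf.ne he.symm

/-- In a regular geometry, at an existing contact `(i, partner)` is an ordered contact pair (the
hypothesis of `nthPartnerOf_eq`, `nthPreData_eq_leftLim`, `approachSpeed_nthPreData_pos`,
`norm_nthContactNormal`). [folklore] -/
theorem mem_contactPairs (h : Ψ.HasNthContact i n z) (hG : G.IsHardSphereRegular ε) :
    (i, Ψ.nthPartnerOf i n z) ∈ contactPairs G ε (loadedProjection (Ψ.nthContactConfig i n z)) := by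
  rcases h.collide_nthPartnerOf with h1 | h2
  · exact h1
  · exact (swap_mem_contactPairs_iff hG (p := (i, Ψ.nthPartnerOf i n z))).1 h2

/-- Between two consecutive existing contacts `i` does not collide. [folklore] -/
theorem not_participates_of_mem_Ioo (h : Ψ.HasNthContact i (n + 1) z) {u : ℝ}
    (hu : u ∈ Ioo (Ψ.nthCollisionTimeOf i n z) (Ψ.nthCollisionTimeOf i (n + 1) z)) :
    ¬ Participates G ε (loadedProjection (Ψ.flow u z)) i := fun hk =>
  (not_le.2 hu.2) ((Ψ.isLeast_nthCollisionTimeOf_succ h.1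
    ((Ψ.nthCollisionTimeOf_lt_succ_iff h.1).1 (h.2.2 n (Nat.lt_succ_self n)))).2 ⟨hk, hu.1⟩)

/-- The flight of `i` ending in its `(n+1)`-st contact started at its `n`-th contact. [folklore] -/
theorem flightStartOf_succ (h : Ψ.HasNthContact i (n + 1) z) :
    Ψ.flightStartOf i (n + 1) z = Ψ.nthCollisionTimeOf i n z := by
  have h' : Ψ.HasNthContact i n z := h.mono (Nat.le_succ n)
  have hlt := h.2.2 n (Nat.lt_succ_self n)
  have hfin := (Ψ.isTrajectory z h.1).finite_collisionTimesOf_inter_Ioo i 0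
    (Ψ.nthCollisionTimeOf i (n + 1) z)
  refine le_antisymm ?_ (le_flightStart_of_mem hfin h'.mem_collisionTimesOf.1 h'.pos hlt)
  rcases (mem_insert_iff.1 (FluidPDE.flightStart_mem hfin)) with h0 | hmem
  · rw [flightStartOf_eq, h0]
    exact h'.pos.le
  · by_contra hlt'
    exact h.not_participates_of_mem_Ioo ⟨not_le.1 hlt', hmem.2.2⟩ hmem.1

end HasNthContact

/-! ### On the good set -/

/-- On the good set every bounded window carries finitely many contact times. [folklore] -/
theorem finite_collisionTimes_inter {z : LoadedConfig N X} (hz : z ∈ Ψ.good) {S : Set ℝ} {a b : ℝ}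
    (hS : S ⊆ Icc a b) : (collisionTimes G ε (fun t => loadedProjection (Ψ.flow t z)) ∩ S).Finite :=
  (Ψ.isTrajectory z hz).finite_collisionTimes_inter_of_subset_Icc hS

/-- **The inline form, along the loaded flow**: on the good set the collision pair sum is
`∑ᶠ s ∈ collisionTimes ∩ S, ∑ i, ∑ j, if i ≠ j ∧ ‖X_i(s) - X_j(s)‖ = ε then g … else 0`. [folklore] -/
theorem collisionPairSum_eq_finsum_ite {M : Type*} [AddCommMonoid M] {z : LoadedConfig N X}
    (hz : z ∈ Ψ.good) (S : Set ℝ) (g : ℝ → LoadedConfig N X → Fin N → Fin N → M) :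
    Ψ.collisionPairSum S g z =
      ∑ᶠ s ∈ collisionTimes G ε (fun t => loadedProjection (Ψ.flow t z)) ∩ S, ∑ i, ∑ j,
        if i ≠ j ∧ ‖G.sepVec (Ψ.flow s z i).1.1 (Ψ.flow s z j).1.1‖ = ε then g s (Ψ.flow s z) i j
        else 0 :=
  FluidPDE.collisionPairSum_eq_finsum_ite (fun t => (Ψ.isTrajectory z hz).loadedProjection_mem t) S _

/-- **The `n`-th partner is THE partner**: on the good set, if the ordered pair `(i, j)` is in
contact at the `n`-th contact time of `i`, then `Ψ.nthPartnerOf i n z = j`. [folklore] -/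
theorem nthPartnerOf_eq {z : LoadedConfig N X} (hz : z ∈ Ψ.good) {i j : Fin N} {n : ℕ}
    (hp : (i, j) ∈ contactPairs G ε (loadedProjection (Ψ.nthContactConfig i n z))) :
    Ψ.nthPartnerOf i n z = j :=
  ((Ψ.isTrajectory z hz).partner_eq (t := Ψ.nthCollisionTimeOf i n z) hp).1

/-- On the good set the flight start of `i` is nonnegative. [folklore] -/
theorem flightStartOf_nonneg {z : LoadedConfig N X} (hz : z ∈ Ψ.good) (i : Fin N) (n : ℕ) :
    0 ≤ Ψ.flightStartOf i n z :=
  (Ψ.isTrajectory z hz).le_flightStart 0 i _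

/-- On the good set the flight start of the partner is nonnegative. [folklore] -/
theorem partnerFlightStartOf_nonneg {z : LoadedConfig N X} (hz : z ∈ Ψ.good) (i : Fin N) (n : ℕ) :
    0 ≤ Ψ.partnerFlightStartOf i n z :=
  (Ψ.isTrajectory z hz).le_flightStart 0 _ _

/-- On the good set, at a positive contact time, the flight of `i` started strictly earlier.
[folklore] -/
theorem flightStartOf_lt {z : LoadedConfig N X} (hz : z ∈ Ψ.good) {i : Fin N} {n : ℕ}
    (hτ : 0 < Ψ.nthCollisionTimeOf i n z) : Ψ.flightStartOf i n z < Ψ.nthCollisionTimeOf i n z :=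
  (Ψ.isTrajectory z hz).flightStart_lt i hτ

/-- On the good set, at a positive contact time, the flight of the partner started strictly
earlier. [folklore] -/
theorem partnerFlightStartOf_lt {z : LoadedConfig N X} (hz : z ∈ Ψ.good) {i : Fin N} {n : ℕ}
    (hτ : 0 < Ψ.nthCollisionTimeOf i n z) :
    Ψ.partnerFlightStartOf i n z < Ψ.nthCollisionTimeOf i n z :=
  (Ψ.isTrajectory z hz).flightStart_lt _ hτ

/-- **The flight of `i` is free**: on the good set `i` does not collide strictly between its flight
start and its `n`-th contact time. [folklore] -/
theorem not_participates_of_mem_Ioo_flightStartOf {z : LoadedConfig N X} (hz : z ∈ Ψ.good)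
    {i : Fin N} {n : ℕ} {u : ℝ} (hu : u ∈ Ioo (Ψ.flightStartOf i n z) (Ψ.nthCollisionTimeOf i n z)) :
    ¬ Participates G ε (loadedProjection (Ψ.flow u z)) i :=
  (Ψ.isTrajectory z hz).not_participates_of_mem_Ioo_flightStart hu

/-- **The flight of the partner is free**: on the good set the partner does not collide strictly
between its flight start and the `n`-th contact time of `i`. [folklore] -/
theorem not_participates_of_mem_Ioo_partnerFlightStartOf {z : LoadedConfig N X} (hz : z ∈ Ψ.good)
    {i : Fin N} {n : ℕ} {u : ℝ}
    (hu : u ∈ Ioo (Ψ.partnerFlightStartOf i n z) (Ψ.nthCollisionTimeOf i n z)) :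
    ¬ Participates G ε (loadedProjection (Ψ.flow u z)) (Ψ.nthPartnerOf i n z) :=
  (Ψ.isTrajectory z hz).not_participates_of_mem_Ioo_flightStart hu

/-- **The incoming data are the left limits**: on the good set, in a Hausdorff position space, at a
genuine contact of `i` with its partner `j` (`(i, j)` an ordered contact pair at the `n`-th contact
time `τ`; `ε ≠ 0`, `0 < ι`), `Ψ.nthPreData i n z` are the pair data of `leftLim (Ψ · z) τ`. [folklore] -/
theorem nthPreData_eq_leftLim [T2Space X] (hε : ε ≠ 0) (hι : 0 < ι) {z : LoadedConfig N X}
    (hz : z ∈ Ψ.good) {i : Fin N} {n : ℕ}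
    (hp : (i, Ψ.nthPartnerOf i n z) ∈ contactPairs G ε (loadedProjection (Ψ.nthContactConfig i n z))) :
    Ψ.nthPreData i n z =
      loadedPairData (leftLim (fun t => Ψ.flow t z) (Ψ.nthCollisionTimeOf i n z)) i
        (Ψ.nthPartnerOf i n z) :=
  (Ψ.isTrajectory z hz).ofConfig_preData_eq_leftLim hε hι (t := Ψ.nthCollisionTimeOf i n z) hp

/-- The incoming data of a genuine contact are incoming: `0 < approachSpeed …` (the material contact
points approach). [folklore] -/
theorem approachSpeed_nthPreData_pos (hε : ε ≠ 0) (hι : 0 < ι) {z : LoadedConfig N X}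
    (hz : z ∈ Ψ.good) {i : Fin N} {n : ℕ}
    (hp : (i, Ψ.nthPartnerOf i n z) ∈ contactPairs G ε (loadedProjection (Ψ.nthContactConfig i n z))) :
    0 < approachSpeed ε ξ ι (Ψ.nthContactPhases i n z).1 (Ψ.nthContactPhases i n z).2
      (Ψ.nthContactNormal i n z) (Ψ.nthPreData i n z) :=
  (Ψ.isTrajectory z hz).approachSpeed_ofConfig_preData_pos hε hι (t := Ψ.nthCollisionTimeOf i n z) hp

/-- At a genuine contact (`0 < ε`) the contact normal is a unit vector, in a regular geometry.
[folklore] -/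
theorem norm_nthContactNormal (hG : G.IsHardSphereRegular ε) (hε : 0 < ε) {z : LoadedConfig N X}
    {i : Fin N} {n : ℕ}
    (hp : (i, Ψ.nthPartnerOf i n z) ∈ contactPairs G ε (loadedProjection (Ψ.nthContactConfig i n z))) :
    ‖Ψ.nthContactNormal i n z‖ = 1 := by
  obtain ⟨-, hc⟩ := mem_contactPairs.1 hp
  have hc' := (hG.mem_contactSet_comm.1 hc)
  have hnorm : ‖G.sepVec (Ψ.nthContactConfig i n z (Ψ.nthPartnerOf i n z)).1.1
      (Ψ.nthContactConfig i n z i).1.1‖ = ε := (mem_contactSet.1 hc').2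
  rw [nthContactNormal, loadedNormal, norm_smul, norm_inv, norm_norm, hnorm, inv_mul_cancel₀ hε.ne']

/-! ### Unit vectors on the good set -/

/-- Along a good orbit the load directions are unit vectors at all times. [folklore] -/
theorem norm_dir_flow {z : LoadedConfig N X} (hz : z ∈ Ψ.good) (t : ℝ) (k : Fin N) :
    ‖(Ψ.flow t z k).2.1‖ = 1 :=
  (Ψ.isTrajectory z hz).norm_dir_eq_one t k

/-- On the good set the first contact phase is a unit vector. [folklore] -/
theorem norm_nthContactPhases_fst {z : LoadedConfig N X} (hz : z ∈ Ψ.good) (i : Fin N) (n : ℕ) :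
    ‖(Ψ.nthContactPhases i n z).1‖ = 1 :=
  Ψ.norm_dir_flow hz _ _

/-- On the good set the second contact phase is a unit vector. [folklore] -/
theorem norm_nthContactPhases_snd {z : LoadedConfig N X} (hz : z ∈ Ψ.good) (i : Fin N) (n : ℕ) :
    ‖(Ψ.nthContactPhases i n z).2‖ = 1 :=
  Ψ.norm_dir_flow hz _ _

/-- On the good set the contact phases lie on `S² × S²`, the support of
`uniformSphereLaw ⊗ uniformSphereLaw`. [folklore] -/
theorem nthContactPhases_mem_sphere_prod {z : LoadedConfig N X} (hz : z ∈ Ψ.good) (i : Fin N)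
    (n : ℕ) : Ψ.nthContactPhases i n z ∈ sphere (0 : E³) 1 ×ˢ sphere (0 : E³) 1 :=
  ⟨mem_sphere_zero_iff_norm.2 (Ψ.norm_nthContactPhases_fst hz i n),
    mem_sphere_zero_iff_norm.2 (Ψ.norm_nthContactPhases_snd hz i n)⟩

/-- Along a good orbit the geometric centres stay in the hard-sphere domain at all times. [folklore] -/
theorem loadedProjection_flow_mem {z : LoadedConfig N X} (hz : z ∈ Ψ.good) (t : ℝ) :
    loadedProjection (Ψ.flow t z) ∈ hardSphereDomain G N ε :=
  (Ψ.isTrajectory z hz).loadedProjection_mem t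

/-! ### The σ-algebras of the coarse past -/

/-- The coarse past generates a sub-σ-algebra of the ambient one as soon as the coarse-past map is
measurable (which it is for measurable cell maps in a regular geometry: companion file). [folklore] -/
theorem coarsePastSigma_le {C Cv : Type*} [MeasurableSpace C] [MeasurableSpace Cv] {q : X → C}
    {qv : E³ → Cv} {i : Fin N} {n : ℕ} (h : Measurable (Ψ.coarsePastOf q qv i n)) :
    Ψ.coarsePastSigma q qv i n ≤ (inferInstance : MeasurableSpace (LoadedConfig N X)) :=
  h.comap_le

/-- The coarse-past map is measurable with respect to the coarse-past σ-algebra (by construction).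
[folklore] -/
theorem measurable_coarsePastOf_coarsePastSigma {C Cv : Type*} [MeasurableSpace C]
    [MeasurableSpace Cv] (q : X → C) (qv : E³ → Cv) (i : Fin N) (n : ℕ) :
    Measurable[Ψ.coarsePastSigma q qv i n] (Ψ.coarsePastOf q qv i n) :=
  comap_measurable _

/-- The coarse past is coarser than the coarse past with the others' data. [folklore] -/
theorem coarsePastSigma_le_coarsePastOthersSigma {C Cv : Type*} [MeasurableSpace C]
    [MeasurableSpace Cv] (q : X → C) (qv : E³ → Cv) (i : Fin N) (n : ℕ) :
    Ψ.coarsePastSigma q qv i n ≤ Ψ.coarsePastOthersSigma q qv i n :=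
  le_sup_left

/-- The others' initial data are measurable with respect to the finer σ-algebra (by construction).
[folklore] -/
theorem measurable_othersInitialOf_coarsePastOthersSigma {C Cv : Type*} [MeasurableSpace C]
    [MeasurableSpace Cv] (q : X → C) (qv : E³ → Cv) (i : Fin N) (n : ℕ) :
    Measurable[Ψ.coarsePastOthersSigma q qv i n] (Ψ.othersInitialOf i n) :=
  (comap_measurable (Ψ.othersInitialOf i n)).mono le_sup_right le_rfl

/-- The coarse-past map is measurable with respect to the finer σ-algebra too. [folklore] -/
theorem measurable_coarsePastOf_coarsePastOthersSigma {C Cv : Type*} [MeasurableSpace C]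
    [MeasurableSpace Cv] (q : X → C) (qv : E³ → Cv) (i : Fin N) (n : ℕ) :
    Measurable[Ψ.coarsePastOthersSigma q qv i n] (Ψ.coarsePastOf q qv i n) :=
  (Ψ.measurable_coarsePastOf_coarsePastSigma q qv i n).mono le_sup_left le_rfl

/-- The finer σ-algebra is a sub-σ-algebra of the ambient one as soon as the coarse-past map and the
others'-data map are measurable (companion file). [folklore] -/
theorem coarsePastOthersSigma_le {C Cv : Type*} [MeasurableSpace C] [MeasurableSpace Cv]
    {q : X → C} {qv : E³ → Cv} {i : Fin N} {n : ℕ} (h : Measurable (Ψ.coarsePastOf q qv i n))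
    (h' : Measurable (Ψ.othersInitialOf i n)) :
    Ψ.coarsePastOthersSigma q qv i n ≤ (inferInstance : MeasurableSpace (LoadedConfig N X)) :=
  sup_le h.comap_le h'.comap_le

end LoadedSphereFlow

end

end Literature.Analysis.FluidPDE
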